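import Literature.Barriers.NavierStokesRegularity.NavierStokesInequalityStructureRecipe
import Literature.Barriers.NavierStokesRegularity.NavierStokesInequalityOpLSeparated
import Mathlib.Analysis.SpecialFunctions.SmoothTransition
import Mathlib.Analysis.Calculus.Deriv.Shift
import HarnessLib

/-!
# Scheffer's block, decomposed (2'): the rectangle cut-off proved (Ożański 2017, Thm. 3.4)

Barrier catalogue support file for `NavierStokesRegularity` (D-0021). This file DISCHARGES the
named fact `Ozanski2017_cutoff_rect` of `NavierStokesInequalityStructureRecipe` (W. S. Ożański,
arXiv:1709.00602v4, Theorem 3.4 in the rectangle case = Appendix A, Lemma "the cut-off function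
on a rectangle" (held-text Lemma 21); V. Scheffer, Comm. Math. Phys. 101 (1985), Lemmas 5.3–5.4):
for an open rectangle `U = (r₁,r₂) × (z₁,z₂)` with `r₁ > 0` and `η > 0` there are `δ ∈ (0,η)` and
`f ∈ C^∞(ℝ²; [0,1])` with `supp f = Ū`, `f > 0` in `U`, `f = 1` on `U_η`, `Lf > 0` on `U ∖ U_δ`
(`L = ∂ᵣ² + ∂_z² + r⁻¹∂ᵣ - r⁻²`, the tree's `opL`), `f` even about the axial midline of `U`.

## The printed proof and this rendering

Ożański (App. A, proof of Lemma 21) takes `f(x₁,x₂) = f₁(x₁) f₂(x₂)` with one-dimensional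
profiles `fᵢ ∈ C_c^∞(ℝ;[0,1])`, `supp fᵢ = [aᵢ,bᵢ]`, `fᵢ = 1` on `[aᵢ+η, bᵢ-η]`, equal to an
exponential `exp(-(x-aᵢ)^{-2})` next to the end-points and symmetric, computes
`Lf = f₁'' f₂ + f₁ (f₂'' + f₂'/x₂ - f₂/x₂²)` and shows `Lf > 0` in the "`d`-corners" and the
"`δ`-strips" from `f'' > 0`, `0 < f' < (x-a) f''`, `f < (x-a)² f''` near the end-points (his
Corollary 20 of a generalised mean value theorem). We follow the same architecture with the
profile equal to `exp(-1/(x-a))` EXACTLY on `(a, a+ε/2]` (Mathlib's `expNegInvGlue`, glued to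
`1` by `Real.smoothTransition`), so that the three inequalities are replaced by the closed forms
`f' = f/s²`, `f'' = f(1-2s)/s⁴` (`s = x - a`), and the corner/strip book-keeping is organised
through the one-variable quantity `Q_c f = f'' - |f'|/c - f/c²` (`c = r₁`), which bounds from
below both `f₂''` and the radial part `G'' + G'/r - G/r²` of `L(G ⊗ F)` (`opL_mul_sep`).
No new facts are introduced.

## References

* W. S. Ożański, arXiv:1709.00602v4, Thm. 3.4, App. A (Lemma 21 of the held text and its proof).
  [`Ozanski2017NSISingular`]
* V. Scheffer, Comm. Math. Phys. 101 (1985) 47–85, §5, Lemmas 5.3–5.4. [`Scheffer1985`]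
-/

noncomputable section

open Set Function Filter Topology Metric Real
open scoped ContDiff

namespace Literature.Barriers.NavierStokesRegularity

/-! ### The exponential `exp(-1/s)` and its first two derivatives -/

/-- `(exp(-1/s))' = exp(-1/s)/s²` for `s ≠ 0`. [folklore] -/
theorem hasDerivAt_exp_neg_inv {s : ℝ} (hs : s ≠ 0) :
    HasDerivAt (fun s : ℝ => exp (-s⁻¹)) (exp (-s⁻¹) * (s ^ 2)⁻¹) s := by
  have h1 : HasDerivAt (fun s : ℝ => -s⁻¹) ((s ^ 2)⁻¹) s := by
    have := (hasDerivAt_inv hs).neg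
    rw [neg_neg] at this
    exact this
  exact h1.exp

/-- `(exp(-1/s)/s²)' = exp(-1/s) (1 - 2s)/s⁴` for `s ≠ 0`. [folklore] -/
theorem hasDerivAt_exp_neg_inv_mul {s : ℝ} (hs : s ≠ 0) :
    HasDerivAt (fun s : ℝ => exp (-s⁻¹) * (s ^ 2)⁻¹) (exp (-s⁻¹) * ((1 - 2 * s) / s ^ 4)) s := by
  have h1 := hasDerivAt_exp_neg_inv hs
  have h2 : HasDerivAt (fun s : ℝ => (s ^ 2)⁻¹) (-(2 * s) / (s ^ 2) ^ 2) s := by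
    refine ((hasDerivAt_pow 2 s).inv (pow_ne_zero 2 hs)).congr_deriv ?_
    norm_num
  refine (h1.mul h2).congr_deriv ?_
  field_simp
  ring

/-- First derivative of `y ↦ exp(-1/(y-a))` off `a`. [folklore] -/
theorem deriv_exp_neg_inv_sub {a y : ℝ} (h : y ≠ a) :
    deriv (fun y => exp (-(y - a)⁻¹)) y = exp (-(y - a)⁻¹) * ((y - a) ^ 2)⁻¹ :=
  ((hasDerivAt_exp_neg_inv (sub_ne_zero.2 h)).comp_sub_const y a).deriv

/-- Second derivative of `y ↦ exp(-1/(y-a))` off `a`. [folklore] -/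
theorem deriv2_exp_neg_inv_sub {a y : ℝ} (h : y ≠ a) :
    deriv (deriv (fun y => exp (-(y - a)⁻¹))) y =
      exp (-(y - a)⁻¹) * ((1 - 2 * (y - a)) / (y - a) ^ 4) := by
  have hev : deriv (fun y => exp (-(y - a)⁻¹)) =ᶠ[𝓝 y]
      fun y => exp (-(y - a)⁻¹) * ((y - a) ^ 2)⁻¹ := by
    filter_upwards [isOpen_ne.mem_nhds h] with w hw
    exact deriv_exp_neg_inv_sub hw
  rw [hev.deriv_eq]
  exact ((hasDerivAt_exp_neg_inv_mul (sub_ne_zero.2 h)).comp_sub_const y a).deriv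

/-- First derivative of `y ↦ exp(-1/(b-y))` off `b`. [folklore] -/
theorem deriv_exp_neg_inv_const_sub {b y : ℝ} (h : y ≠ b) :
    deriv (fun y => exp (-(b - y)⁻¹)) y = -(exp (-(b - y)⁻¹) * ((b - y) ^ 2)⁻¹) :=
  ((hasDerivAt_exp_neg_inv (sub_ne_zero.2 (Ne.symm h))).comp_const_sub b y).deriv

/-- Second derivative of `y ↦ exp(-1/(b-y))` off `b`. [folklore] -/
theorem deriv2_exp_neg_inv_const_sub {b y : ℝ} (h : y ≠ b) :
    deriv (deriv (fun y => exp (-(b - y)⁻¹))) y =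
      exp (-(b - y)⁻¹) * ((1 - 2 * (b - y)) / (b - y) ^ 4) := by
  have hev : deriv (fun y => exp (-(b - y)⁻¹)) =ᶠ[𝓝 y]
      fun y => -(exp (-(b - y)⁻¹) * ((b - y) ^ 2)⁻¹) := by
    filter_upwards [isOpen_ne.mem_nhds h] with w hw
    exact deriv_exp_neg_inv_const_sub hw
  rw [hev.deriv_eq]
  have := (((hasDerivAt_exp_neg_inv_mul (sub_ne_zero.2 (Ne.symm h))).comp_const_sub b y).neg).deriv
  rw [neg_neg] at this
  exact this

/-! ### A smooth step equal to `exp(-1/x)` on `(0, ε/2]` and to `1` on `[ε, ∞)` -/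

/-- The one-dimensional step `h_ε(x) = 1 - χ(2(ε-x)/ε) (1 - expNegInvGlue x)`, `χ` Mathlib's
`Real.smoothTransition`: smooth, `= expNegInvGlue` on `(-∞, ε/2]`, `= 1` on `[ε, ∞)`, values in
`[0,1]`, positive on `(0,∞)` (a concrete choice of the profile near one end-point in the proof of
Ożański's Lemma 21: "`fᵢ(x) = exp(-(x-aᵢ)^{-2})` on `(aᵢ, aᵢ+ε)`, `1` on `(aᵢ+η, bᵢ-η)`, and define
`fᵢ` on the remaining intervals in the way such that `fᵢ ∈ C^∞`, `fᵢ ≤ 1`"; here with `exp(-1/x)`).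
[cite: Ozanski2017NSISingular, App. A, proof of Lemma 21] -/
def cutoffStep (ε x : ℝ) : ℝ :=
  1 - Real.smoothTransition (2 * (ε - x) / ε) * (1 - expNegInvGlue x)

/-- The step `h_ε` is smooth. [folklore] -/
theorem cutoffStep_contDiff (ε : ℝ) : ContDiff ℝ ∞ (cutoffStep ε) := by
  have h1 : ContDiff ℝ ∞ (fun x : ℝ => 2 * (ε - x) / ε) := by fun_prop
  have h2 : ContDiff ℝ ∞ (fun x => Real.smoothTransition (2 * (ε - x) / ε)) :=
    Real.smoothTransition.contDiff.comp h1
  show ContDiff ℝ ∞ (fun x => 1 - Real.smoothTransition (2 * (ε - x) / ε) * (1 - expNegInvGlue x))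
  exact contDiff_const.sub (h2.mul (contDiff_const.sub expNegInvGlue.contDiff))

/-- `h_ε = expNegInvGlue` on `(-∞, ε/2]` (for `ε > 0`). [folklore] -/
theorem cutoffStep_of_le_half {ε x : ℝ} (hε : 0 < ε) (hx : x ≤ ε / 2) :
    cutoffStep ε x = expNegInvGlue x := by
  have h1 : (1 : ℝ) ≤ 2 * (ε - x) / ε := by
    rw [le_div_iff₀ hε]; linarith
  rw [cutoffStep, Real.smoothTransition.one_of_one_le h1]; ring

/-- `h_ε = 1` on `[ε, ∞)` (for `ε > 0`). [folklore] -/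
theorem cutoffStep_of_le {ε x : ℝ} (hε : 0 < ε) (hx : ε ≤ x) : cutoffStep ε x = 1 := by
  have h1 : 2 * (ε - x) / ε ≤ 0 := div_nonpos_of_nonpos_of_nonneg (by linarith) hε.le
  rw [cutoffStep, Real.smoothTransition.zero_of_nonpos h1]; ring

/-- `h_ε = 0` on `(-∞, 0]` (for `ε > 0`). [folklore] -/
theorem cutoffStep_of_nonpos {ε x : ℝ} (hε : 0 < ε) (hx : x ≤ 0) : cutoffStep ε x = 0 := by
  rw [cutoffStep_of_le_half hε (hx.trans (by positivity)), expNegInvGlue.zero_of_nonpos hx]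

/-- `0 ≤ h_ε ≤ 1` everywhere and `h_ε > 0` on `(0, ∞)`: with `χ ∈ [0,1]` and
`e = expNegInvGlue x ∈ [0,1)`, `h_ε = 1 - χ(1-e) ∈ [e, 1]`. [folklore] -/
theorem cutoffStep_bounds (ε x : ℝ) :
    0 ≤ cutoffStep ε x ∧ cutoffStep ε x ≤ 1 ∧ (0 < x → 0 < cutoffStep ε x) := by
  have he1 : expNegInvGlue x < 1 := by
    unfold expNegInvGlue
    split_ifs with h
    · exact zero_lt_one
    · exact exp_lt_one_iff.2 (neg_lt_zero.2 (inv_pos.2 (not_le.1 h)))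
  have he := expNegInvGlue.nonneg x
  have hχ0 := Real.smoothTransition.nonneg (2 * (ε - x) / ε)
  have hχ1 := Real.smoothTransition.le_one (2 * (ε - x) / ε)
  have hprod := mul_le_mul_of_nonneg_right hχ1 (sub_nonneg.2 he1.le)
  have hprod0 := mul_nonneg hχ0 (sub_nonneg.2 he1.le)
  unfold cutoffStep
  exact ⟨by linarith, by linarith, fun hx => by linarith [expNegInvGlue.pos_of_pos hx]⟩

/-- `h_ε > 0` on `(0, ∞)`. [folklore] -/
theorem cutoffStep_pos {ε x : ℝ} (hx : 0 < x) : 0 < cutoffStep ε x :=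
  (cutoffStep_bounds ε x).2.2 hx

/-- `0 ≤ h_ε`. [folklore] -/
theorem cutoffStep_nonneg (ε x : ℝ) : 0 ≤ cutoffStep ε x :=
  (cutoffStep_bounds ε x).1

/-- `h_ε ≤ 1`. [folklore] -/
theorem cutoffStep_le_one (ε x : ℝ) : cutoffStep ε x ≤ 1 :=
  (cutoffStep_bounds ε x).2.1

/-! ### The one-dimensional profile on `[a, b]` -/

/-- The profile `fᵢ` of Ożański's Lemma 21 on `[a,b]`: `P(x) = h_ε(x-a) h_ε(b-x)`; for `2ε ≤ b-a`
it equals `exp(-1/(x-a))` on `(a, a+ε/2]`, `1` on `[a+ε, b-ε]`, `exp(-1/(b-x))` on `[b-ε/2, b)`,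
vanishes off `(a,b)` and is symmetric about `(a+b)/2`.
[cite: Ozanski2017NSISingular, App. A, proof of Lemma 21] -/
def cutoffProfile (a b ε x : ℝ) : ℝ :=
  cutoffStep ε (x - a) * cutoffStep ε (b - x)

/-- The profile is smooth ("`fᵢ ∈ C_0^∞(ℝ; [0,1])`").
[cite: Ozanski2017NSISingular, App. A, proof of Lemma 21] -/
theorem cutoffProfile_contDiff (a b ε : ℝ) : ContDiff ℝ ∞ (cutoffProfile a b ε) := by
  show ContDiff ℝ ∞ (fun x => cutoffStep ε (x - a) * cutoffStep ε (b - x))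
  exact ((cutoffStep_contDiff ε).comp (contDiff_id.sub contDiff_const)).mul
    ((cutoffStep_contDiff ε).comp (contDiff_const.sub contDiff_id))

/-- `0 ≤ P`. [cite: Ozanski2017NSISingular, App. A, proof of Lemma 21] -/
theorem cutoffProfile_nonneg (a b ε x : ℝ) : 0 ≤ cutoffProfile a b ε x :=
  mul_nonneg (cutoffStep_nonneg _ _) (cutoffStep_nonneg _ _)

/-- `P ≤ 1`. [cite: Ozanski2017NSISingular, App. A, proof of Lemma 21] -/
theorem cutoffProfile_le_one (a b ε x : ℝ) : cutoffProfile a b ε x ≤ 1 :=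
  mul_le_one₀ (cutoffStep_le_one _ _) (cutoffStep_nonneg _ _) (cutoffStep_le_one _ _)

/-- `P > 0` on `(a, b)` ("`fᵢ > 0` on `(aᵢ, bᵢ)`").
[cite: Ozanski2017NSISingular, App. A, proof of Lemma 21] -/
theorem cutoffProfile_pos {a b ε x : ℝ} (hxa : a < x) (hxb : x < b) : 0 < cutoffProfile a b ε x :=
  mul_pos (cutoffStep_pos (sub_pos.2 hxa)) (cutoffStep_pos (sub_pos.2 hxb))

/-- `supp P = [a, b]`: `P x ≠ 0 ↔ x ∈ (a, b)` (for `ε > 0`).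
[cite: Ozanski2017NSISingular, App. A, proof of Lemma 21] -/
theorem cutoffProfile_ne_zero_iff {a b ε x : ℝ} (hε : 0 < ε) :
    cutoffProfile a b ε x ≠ 0 ↔ a < x ∧ x < b := by
  refine ⟨fun h => ?_, fun h => (cutoffProfile_pos h.1 h.2).ne'⟩
  by_contra hc
  rw [not_and_or, not_lt, not_lt] at hc
  rcases hc with hc | hc
  · exact h (by rw [cutoffProfile, cutoffStep_of_nonpos hε (sub_nonpos.2 hc), zero_mul])
  · exact h (by rw [cutoffProfile, cutoffStep_of_nonpos hε (sub_nonpos.2 hc), mul_zero])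

/-- `P = 1` on `[a + ε, b - ε]` (so on `[a + η, b - η]` once `ε ≤ η`).
[cite: Ozanski2017NSISingular, App. A, proof of Lemma 21] -/
theorem cutoffProfile_eq_one {a b ε x : ℝ} (hε : 0 < ε) (h1 : a + ε ≤ x) (h2 : x ≤ b - ε) :
    cutoffProfile a b ε x = 1 := by
  rw [cutoffProfile, cutoffStep_of_le hε (by linarith), cutoffStep_of_le hε (by linarith), mul_one]

/-- Symmetry about the midpoint: `P(a + b - x) = P(x)`
("`fᵢ((aᵢ+bᵢ)/2 - x) = fᵢ((aᵢ+bᵢ)/2 + x)`").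
[cite: Ozanski2017NSISingular, App. A, proof of Lemma 21] -/
theorem cutoffProfile_symm (a b ε x : ℝ) :
    cutoffProfile a b ε (a + b - x) = cutoffProfile a b ε x := by
  simp only [cutoffProfile]
  rw [show a + b - x - a = b - x by ring, show b - (a + b - x) = x - a by ring, mul_comm]

/-- Near the left end-point the profile IS `exp(-1/(x-a))` ("`fᵢ(x) = exp(-(x-aᵢ)^{-2})`,
`x ∈ (aᵢ, aᵢ+ε)`" in print; here `exp(-1/(x-a))` on `(a, a+ε/2)`).
[cite: Ozanski2017NSISingular, App. A, proof of Lemma 21] -/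
theorem cutoffProfile_eventuallyEq_left {a b ε x : ℝ} (hε : 0 < ε) (hab : 2 * ε ≤ b - a)
    (hxa : a < x) (hx : x < a + ε / 2) : cutoffProfile a b ε =ᶠ[𝓝 x] fun y => exp (-(y - a)⁻¹) := by
  filter_upwards [isOpen_Ioo.mem_nhds (show x ∈ Ioo a (a + ε / 2) from ⟨hxa, hx⟩)] with y hy
  have h1 : cutoffStep ε (b - y) = 1 := cutoffStep_of_le hε (by linarith [hy.2])
  have h2 : cutoffStep ε (y - a) = expNegInvGlue (y - a) :=
    cutoffStep_of_le_half hε (by linarith [hy.2])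
  have h3 : expNegInvGlue (y - a) = exp (-(y - a)⁻¹) := by
    simp [expNegInvGlue, not_le.2 (sub_pos.2 hy.1)]
  simp only [cutoffProfile, h1, h2, h3, mul_one]

/-- Near the right end-point the profile IS `exp(-1/(b-x))`.
[cite: Ozanski2017NSISingular, App. A, proof of Lemma 21] -/
theorem cutoffProfile_eventuallyEq_right {a b ε x : ℝ} (hε : 0 < ε) (hab : 2 * ε ≤ b - a)
    (hxb : x < b) (hx : b - ε / 2 < x) : cutoffProfile a b ε =ᶠ[𝓝 x] fun y => exp (-(b - y)⁻¹) := by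
  filter_upwards [isOpen_Ioo.mem_nhds (show x ∈ Ioo (b - ε / 2) b from ⟨hx, hxb⟩)] with y hy
  have h1 : cutoffStep ε (y - a) = 1 := cutoffStep_of_le hε (by linarith [hy.1])
  have h2 : cutoffStep ε (b - y) = expNegInvGlue (b - y) :=
    cutoffStep_of_le_half hε (by linarith [hy.1])
  have h3 : expNegInvGlue (b - y) = exp (-(b - y)⁻¹) := by
    simp [expNegInvGlue, not_le.2 (sub_pos.2 hy.2)]
  simp only [cutoffProfile, h1, h2, h3, one_mul]

/-- Values of `P, P', P''` on `(a, a + ε/2)` (`s = x - a`): `e, e/s², e(1-2s)/s⁴` (the closed forms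
replacing `f'' > 0`, `0 < f' < (x-a)f''`, `f < (x-a)²f''` of Corollary 20).
[cite: Ozanski2017NSISingular, App. A, Corollary 20 and proof of Lemma 21] -/
theorem cutoffProfile_left {a b ε x : ℝ} (hε : 0 < ε) (hab : 2 * ε ≤ b - a) (hxa : a < x)
    (hx : x < a + ε / 2) :
    cutoffProfile a b ε x = exp (-(x - a)⁻¹) ∧
      deriv (cutoffProfile a b ε) x = exp (-(x - a)⁻¹) * ((x - a) ^ 2)⁻¹ ∧
      deriv (deriv (cutoffProfile a b ε)) x =
        exp (-(x - a)⁻¹) * ((1 - 2 * (x - a)) / (x - a) ^ 4) := by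
  have hev := cutoffProfile_eventuallyEq_left hε hab hxa hx
  exact ⟨hev.eq_of_nhds, by rw [hev.deriv_eq]; exact deriv_exp_neg_inv_sub hxa.ne',
    by rw [hev.deriv.deriv_eq]; exact deriv2_exp_neg_inv_sub hxa.ne'⟩

/-- Values of `P, P', P''` on `(b - ε/2, b)` (`s = b - x`): `e, -e/s², e(1-2s)/s⁴` (the case
`g(x) = f(2a - x)` of Corollary 20).
[cite: Ozanski2017NSISingular, App. A, Corollary 20 and proof of Lemma 21] -/
theorem cutoffProfile_right {a b ε x : ℝ} (hε : 0 < ε) (hab : 2 * ε ≤ b - a) (hxb : x < b)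
    (hx : b - ε / 2 < x) :
    cutoffProfile a b ε x = exp (-(b - x)⁻¹) ∧
      deriv (cutoffProfile a b ε) x = -(exp (-(b - x)⁻¹) * ((b - x) ^ 2)⁻¹) ∧
      deriv (deriv (cutoffProfile a b ε)) x =
        exp (-(b - x)⁻¹) * ((1 - 2 * (b - x)) / (b - x) ^ 4) := by
  have hev := cutoffProfile_eventuallyEq_right hε hab hxb hx
  exact ⟨hev.eq_of_nhds, by rw [hev.deriv_eq]; exact deriv_exp_neg_inv_const_sub hxb.ne,
    by rw [hev.deriv.deriv_eq]; exact deriv2_exp_neg_inv_const_sub hxb.ne⟩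

/-! ### The quantity `Q_c P = P'' - |P'|/c - P/c²` -/

/-- `Q_c P (x) = P''(x) - |P'(x)|/c - P(x)/c²`: a common lower bound for `P''` and, for `r ≥ c`,
for the radial part `P'' + P'/r - P/r²` of Scheffer's `L` on a separated product. [folklore] -/
def cutoffQ (c : ℝ) (P : ℝ → ℝ) (x : ℝ) : ℝ :=
  deriv (deriv P) x - |deriv P x| / c - P x / c ^ 2

/-- The edge algebra: for `0 < s ≤ 1/4`, `s² ≤ c/4`,
`e (1/(4s⁴) - 1/c²) ≤ e (1-2s)/s⁴ - (e/s²)/c - e/c²`. [folklore] -/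
theorem cutoffProfile_edge_algebra {e s c : ℝ} (he : 0 < e) (hc : 0 < c) (hs0 : 0 < s)
    (hs1 : s ≤ 1 / 4) (hs2 : s ^ 2 ≤ c / 4) :
    e * (1 / (4 * s ^ 4) - 1 / c ^ 2) ≤
      e * ((1 - 2 * s) / s ^ 4) - e * (s ^ 2)⁻¹ / c - e / c ^ 2 := by
  have key : 1 / (4 * s ^ 4) ≤ (1 - 2 * s) / s ^ 4 - (s ^ 2)⁻¹ / c := by
    rw [← sub_nonneg]
    have : (1 - 2 * s) / s ^ 4 - (s ^ 2)⁻¹ / c - 1 / (4 * s ^ 4) =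
        (3 * c / 4 - 2 * s * c - s ^ 2) / (c * s ^ 4) := by
      field_simp
      ring
    rw [this]
    exact div_nonneg (by nlinarith) (by positivity)
  have : e * ((1 - 2 * s) / s ^ 4) - e * (s ^ 2)⁻¹ / c - e / c ^ 2 =
      e * ((1 - 2 * s) / s ^ 4 - (s ^ 2)⁻¹ / c - 1 / c ^ 2) := by ring
  rw [this]
  exact mul_le_mul_of_nonneg_left (by linarith) he.le

/-- **Edge bound.** For `0 < ε ≤ 1/2`, `ε ≤ c`, `2ε ≤ b - a` and `x ∈ (a,b)` with
`s = min (x-a) (b-x) < ε/2`: `Q_c P (x) ≥ P(x) (1/(4s⁴) - 1/c²)`.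
[cite: Ozanski2017NSISingular, App. A, proof of Lemma 21 (the Claim and Corollary 20)] -/
theorem cutoffProfile_edge {a b ε c x : ℝ} (hε : 0 < ε) (hε2 : ε ≤ 1 / 2) (hc : 0 < c)
    (hεc : ε ≤ c) (hab : 2 * ε ≤ b - a) (hxa : a < x) (hxb : x < b)
    (hs : min (x - a) (b - x) < ε / 2) :
    cutoffProfile a b ε x * (1 / (4 * (min (x - a) (b - x)) ^ 4) - 1 / c ^ 2) ≤
      cutoffQ c (cutoffProfile a b ε) x := by
  have hεε : ε ^ 2 ≤ c := by nlinarith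
  rcases le_or_gt (x - a) (b - x) with h | h
  · rw [min_eq_left h] at hs ⊢
    obtain ⟨h0, h1, h2⟩ := cutoffProfile_left hε hab hxa (by linarith)
    rw [cutoffQ, h0, h1, h2, abs_of_pos (by positivity)]
    exact cutoffProfile_edge_algebra (exp_pos _) hc (sub_pos.2 hxa) (by linarith) (by nlinarith)
  · rw [min_eq_right h.le] at hs ⊢
    obtain ⟨h0, h1, h2⟩ := cutoffProfile_right hε hab hxb (by linarith)
    rw [cutoffQ, h0, h1, h2, abs_neg, abs_of_pos (by positivity)]
    exact cutoffProfile_edge_algebra (exp_pos _) hc (sub_pos.2 hxb) (by linarith) (by nlinarith)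

/-- **Middle bounds.** On `[a + ε/2, b - ε/2]` the profile is bounded below by some `m > 0` and
`Q_c P` by some `-M ≤ 0` (continuity on a compact interval).
[cite: Ozanski2017NSISingular, App. A, proof of Lemma 21 ("let m, M > 0 be such that
fᵢ > m, |gᵢ| < M in [aᵢ+d, bᵢ-d]")] -/
theorem cutoffProfile_middle {a b ε : ℝ} (hε : 0 < ε) (hab : 2 * ε ≤ b - a) (c : ℝ) :
    ∃ m M : ℝ, 0 < m ∧ 0 ≤ M ∧ ∀ x, a + ε / 2 ≤ x → x ≤ b - ε / 2 →
      m ≤ cutoffProfile a b ε x ∧ -M ≤ cutoffQ c (cutoffProfile a b ε) x := by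
  have hK : IsCompact (Icc (a + ε / 2) (b - ε / 2)) := isCompact_Icc
  have hne : (Icc (a + ε / 2) (b - ε / 2)).Nonempty := nonempty_Icc.2 (by linarith)
  have hP := cutoffProfile_contDiff a b ε
  have hPc : Continuous (cutoffProfile a b ε) := hP.continuous
  obtain ⟨x₀, hx₀, hmin⟩ := hK.exists_isMinOn hne hPc.continuousOn
  have h3 : ContDiff ℝ 3 (cutoffProfile a b ε) := contDiff_infty.1 hP 3
  have hd1 : ContDiff ℝ 2 (deriv (cutoffProfile a b ε)) := h3.deriv' (n := 2)
  have hd2 : ContDiff ℝ 1 (deriv (deriv (cutoffProfile a b ε))) := hd1.deriv' (n := 1)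
  have hQc : Continuous (cutoffQ c (cutoffProfile a b ε)) := by
    show Continuous (fun x => deriv (deriv (cutoffProfile a b ε)) x -
      |deriv (cutoffProfile a b ε) x| / c - cutoffProfile a b ε x / c ^ 2)
    exact (hd2.continuous.sub (hd1.continuous.abs.div_const c)).sub (hPc.div_const _)
  obtain ⟨C, hC⟩ := hK.exists_bound_of_continuousOn hQc.continuousOn
  refine ⟨cutoffProfile a b ε x₀, |C|,
    cutoffProfile_pos (by linarith [hx₀.1]) (by linarith [hx₀.2]), abs_nonneg C,
    fun x h1 h2 => ⟨hmin ⟨h1, h2⟩, ?_⟩⟩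
  have h := hC x ⟨h1, h2⟩
  rw [Real.norm_eq_abs] at h
  exact (abs_le.1 (h.trans (le_abs_self C))).1

/-- **Arithmetic of the `d`-corners and `δ`-strips** (one orientation). At a point of the strip
along an edge transversal to the first variable: `G, F > 0` the two profile values, `A ≥ G L` the
part of `Lf` multiplying `F`, `F₂ ≥ Q_F` the part multiplying `G`, and in the second variable either
the edge bound `Q_F ≥ F(κ - c₂)`, `κ ≥ 0`, or the middle bounds `F ≥ m_F`, `Q_F ≥ -M_F`;
then `F A + F₂ G > 0` provided `L > c₂`, `L > 0`, `m_F L > M_F`.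
[cite: Ozanski2017NSISingular, App. A, proof of Lemma 21 (last two displays)] -/
theorem cutoff_strip_core {G F A F₂ Q L c₂ m M κ : ℝ} (hG : 0 < G) (hF : 0 < F)
    (hA : G * L ≤ A) (hFQ : Q ≤ F₂) (halt : (F * (κ - c₂) ≤ Q ∧ 0 ≤ κ) ∨ (m ≤ F ∧ -M ≤ Q))
    (hLc : c₂ < L) (hL0 : 0 < L) (hLF : M < m * L) : 0 < F * A + F₂ * G := by
  have hFz : 0 < F * L + F₂ := by
    rcases halt with ⟨hQ, hκ⟩ | ⟨hm, hM⟩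
    · have h1 : 0 < F * (L - c₂) := mul_pos hF (sub_pos.2 hLc)
      have h2 : 0 ≤ F * κ := mul_nonneg hF.le hκ
      linarith
    · have h1 : m * L ≤ F * L := mul_le_mul_of_nonneg_right hm hL0.le
      linarith
  have h3 : F * (G * L) ≤ F * A := mul_le_mul_of_nonneg_left hA hF.le
  have h4 : 0 < G * (F * L + F₂) := mul_pos hG hFz
  linarith

/-! ### The discharge -/

/-- **Ożański 2017, Theorem 3.4 (rectangle case; App. A, Lemma 21; Scheffer 1985,
Lemmas 5.3–5.4), proved.** With `ε = min(η, 1/2, (r₂-r₁)/2, (z₂-z₁)/2, r₁)` and the profiles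
`G = P_{r₁,r₂}`, `F = P_{z₁,z₂}` above, `f(r,z) = G(r) F(z)` has `supp f = Ū`, `0 ≤ f ≤ 1`,
`f > 0` in `U`, `f = 1` on `U_η`, is even in `z` about the midline, and
`Lf = F (G'' + G'/r - G/r²) + F'' G > 0` (`opL_mul_sep`) on `U ∖ U_δ` for
`δ = min(ε/4, 1/(4K))`, `K = 2/r₁² + M_G/m_G + M_F/m_F + 1` (middle bounds `m, M` of
`cutoffProfile_middle`, edge bound `cutoffProfile_edge`).
[cite: Ozanski2017NSISingular, Theorem 3.4 and App. A, Lemma 21]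
[cite: Scheffer1985, Lemmas 5.3–5.4] -/
theorem Ozanski2017_cutoff_rect_holds : Ozanski2017_cutoff_rect := by
  intro r₁ r₂ z₁ z₂ hr₁ hr hz η hη
  -- the gluing scale `ε`
  obtain ⟨ε, hε, hεη, hε2, hεr, hεz, hεc⟩ : ∃ ε : ℝ, 0 < ε ∧ ε ≤ η ∧ ε ≤ 1 / 2 ∧
      2 * ε ≤ r₂ - r₁ ∧ 2 * ε ≤ z₂ - z₁ ∧ ε ≤ r₁ := by
    refine ⟨min η (min (1 / 2) (min ((r₂ - r₁) / 2) (min ((z₂ - z₁) / 2) r₁))),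
      lt_min hη (lt_min (by norm_num) (lt_min (by linarith) (lt_min (by linarith) hr₁))),
      min_le_left _ _, (min_le_right _ _).trans (min_le_left _ _), ?_, ?_,
      (min_le_right _ _).trans ((min_le_right _ _).trans ((min_le_right _ _).trans
        (min_le_right _ _)))⟩
    · have : min η (min (1 / 2) (min ((r₂ - r₁) / 2) (min ((z₂ - z₁) / 2) r₁))) ≤
          (r₂ - r₁) / 2 :=
        (min_le_right _ _).trans ((min_le_right _ _).trans (min_le_left _ _))
      linarith
    · have : min η (min (1 / 2) (min ((r₂ - r₁) / 2) (min ((z₂ - z₁) / 2) r₁))) ≤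
          (z₂ - z₁) / 2 :=
        (min_le_right _ _).trans ((min_le_right _ _).trans ((min_le_right _ _).trans
          (min_le_left _ _)))
      linarith
  -- the profiles and their middle bounds
  set G : ℝ → ℝ := cutoffProfile r₁ r₂ ε with hGdef
  set F : ℝ → ℝ := cutoffProfile z₁ z₂ ε with hFdef
  obtain ⟨mG, MG, hmG, hMG, hGmid⟩ := cutoffProfile_middle hε hεr r₁
  obtain ⟨mF, MF, hmF, hMF, hFmid⟩ := cutoffProfile_middle hε hεz r₁
  -- the constants
  obtain ⟨c2, hc2⟩ : ∃ c2 : ℝ, 1 / r₁ ^ 2 = c2 := ⟨_, rfl⟩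
  have hc2pos : 0 < c2 := by rw [← hc2]; positivity
  obtain ⟨ρG, hρG⟩ : ∃ ρ : ℝ, MG / mG = ρ := ⟨_, rfl⟩
  obtain ⟨ρF, hρF⟩ : ∃ ρ : ℝ, MF / mF = ρ := ⟨_, rfl⟩
  have hρG0 : 0 ≤ ρG := by rw [← hρG]; positivity
  have hρF0 : 0 ≤ ρF := by rw [← hρF]; positivity
  have hρGm : mG * ρG = MG := by rw [← hρG]; field_simp
  have hρFm : mF * ρF = MF := by rw [← hρF]; field_simp
  obtain ⟨L, hL⟩ : ∃ L : ℝ, c2 + ρG + ρF + 1 = L := ⟨_, rfl⟩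
  have hLc : c2 < L := by linarith
  have hL0 : 0 < L := by linarith
  have hLG : MG < mG * L := by
    have e1 : mG * L = mG * c2 + MG + mG * ρF + mG := by rw [← hL]; linear_combination hρGm
    have e2 : 0 < mG * c2 := mul_pos hmG hc2pos
    have e3 : 0 ≤ mG * ρF := mul_nonneg hmG.le hρF0
    linarith
  have hLF : MF < mF * L := by
    have e1 : mF * L = mF * c2 + mF * ρG + MF + mF := by rw [← hL]; linear_combination hρFm
    have e2 : 0 < mF * c2 := mul_pos hmF hc2pos
    have e3 : 0 ≤ mF * ρG := mul_nonneg hmF.le hρG0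
    linarith
  obtain ⟨K, hK⟩ : ∃ K : ℝ, L + c2 = K := ⟨_, rfl⟩
  have hK0 : 0 < K := by linarith
  -- the width `d` of the strip (this is `δ`)
  obtain ⟨d, hd0, hdε, hdK⟩ : ∃ d : ℝ, 0 < d ∧ d < ε / 2 ∧
      ∀ s, 0 < s → s ≤ d → K ≤ 1 / (4 * s ^ 4) := by
    refine ⟨min (ε / 4) (1 / (4 * K)), lt_min (by positivity) (by positivity),
      (min_le_left _ _).trans_lt (by linarith), fun s hs0 hsd => ?_⟩
    have hs1 : s ≤ 1 := hsd.trans ((min_le_left _ _).trans (by linarith))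
    have hs4 : s ^ 4 ≤ s := pow_le_of_le_one hs0.le hs1 (by norm_num)
    have hsK : s ≤ 1 / (4 * K) := hsd.trans (min_le_right _ _)
    rw [le_div_iff₀ (by positivity)]
    calc K * (4 * s ^ 4) ≤ K * (4 * s) :=
          mul_le_mul_of_nonneg_left (mul_le_mul_of_nonneg_left hs4 (by norm_num)) hK0.le
      _ ≤ K * (4 * (1 / (4 * K))) :=
          mul_le_mul_of_nonneg_left (mul_le_mul_of_nonneg_left hsK (by norm_num)) hK0.le
      _ = 1 := by field_simp
  refine ⟨d, ⟨hd0, by linarith⟩, fun q => G q.1 * F q.2, ?_, ?_, ?_, ?_, ?_, ?_, ?_⟩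
  · -- smoothness
    exact ((cutoffProfile_contDiff r₁ r₂ ε).comp contDiff_fst).mul
      ((cutoffProfile_contDiff z₁ z₂ ε).comp contDiff_snd)
  · -- values in `[0,1]`
    exact fun q => ⟨mul_nonneg (cutoffProfile_nonneg _ _ _ _) (cutoffProfile_nonneg _ _ _ _),
      mul_le_one₀ (cutoffProfile_le_one _ _ _ _) (cutoffProfile_nonneg _ _ _ _)
        (cutoffProfile_le_one _ _ _ _)⟩
  · -- `supp f = Ū`
    have hs : support (fun q : ℝ × ℝ => G q.1 * F q.2) = rect r₁ r₂ z₁ z₂ := by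
      ext q
      rw [mem_support, mul_ne_zero_iff, hGdef, hFdef, cutoffProfile_ne_zero_iff hε,
        cutoffProfile_ne_zero_iff hε, mem_rect]
    rw [tsupport, hs]
  · -- `f > 0` in `U`
    intro q hq
    rw [mem_rect] at hq
    exact mul_pos (cutoffProfile_pos hq.1.1 hq.1.2) (cutoffProfile_pos hq.2.1 hq.2.2)
  · -- `f = 1` on `U_η`
    intro q hq
    rw [mem_rect] at hq
    change cutoffProfile r₁ r₂ ε q.1 * cutoffProfile z₁ z₂ ε q.2 = 1
    rw [cutoffProfile_eq_one hε (by linarith [hq.1.1]) (by linarith [hq.1.2]),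
      cutoffProfile_eq_one hε (by linarith [hq.2.1]) (by linarith [hq.2.2]), mul_one]
  · -- `Lf > 0` on the `δ`-strip
    rintro ⟨r, z⟩ ⟨hqU, hqδ⟩
    rw [mem_rect] at hqU
    obtain ⟨⟨h1r, h2r⟩, h1z, h2z⟩ := hqU
    have hstrip : min (r - r₁) (r₂ - r) ≤ d ∨ min (z - z₁) (z₂ - z) ≤ d := by
      by_contra hcon
      rw [not_or, not_le, not_le, lt_min_iff, lt_min_iff] at hcon
      exact hqδ (mem_rect.2 ⟨⟨by linarith [hcon.1.1], by linarith [hcon.1.2]⟩,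
        by linarith [hcon.2.1], by linarith [hcon.2.2]⟩)
    have hG2 : ContDiff ℝ 2 G := contDiff_infty.1 (cutoffProfile_contDiff r₁ r₂ ε) 2
    have hF2 : ContDiff ℝ 2 F := contDiff_infty.1 (cutoffProfile_contDiff z₁ z₂ ε) 2
    rw [opL_mul_sep hG2 hF2]
    simp only
    have hr0 : 0 < r := hr₁.trans h1r
    have hGpos : 0 < G r := cutoffProfile_pos h1r h2r
    have hFpos : 0 < F z := cutoffProfile_pos h1z h2z
    have hsr0 : 0 < min (r - r₁) (r₂ - r) := lt_min (by linarith) (by linarith)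
    have hsz0 : 0 < min (z - z₁) (z₂ - z) := lt_min (by linarith) (by linarith)
    -- the radial part of `L` dominates `Q_{r₁} G`, and `F''` dominates `Q_{r₁} F`
    have hAQ : cutoffQ r₁ G r ≤ deriv (deriv G) r + r⁻¹ * deriv G r - G r / r ^ 2 := by
      have h1 : -(|deriv G r| / r₁) ≤ r⁻¹ * deriv G r := by
        rw [neg_le]
        calc -(r⁻¹ * deriv G r) ≤ |r⁻¹ * deriv G r| := neg_le_abs _
          _ = r⁻¹ * |deriv G r| := by rw [abs_mul, abs_of_pos (inv_pos.2 hr0)]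
          _ ≤ r₁⁻¹ * |deriv G r| :=
            mul_le_mul_of_nonneg_right ((inv_le_inv₀ hr0 hr₁).2 h1r.le) (abs_nonneg _)
          _ = |deriv G r| / r₁ := by rw [div_eq_inv_mul]
      have h2 : G r / r ^ 2 ≤ G r / r₁ ^ 2 :=
        div_le_div_of_nonneg_left hGpos.le (by positivity) (pow_le_pow_left₀ hr₁.le h1r.le 2)
      unfold cutoffQ
      linarith
    have hFQ : cutoffQ r₁ F z ≤ deriv (deriv F) z := by
      have h1 : 0 ≤ |deriv F z| / r₁ := by positivity
      have h2 : 0 ≤ F z / r₁ ^ 2 := by positivity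
      unfold cutoffQ
      linarith
    -- edge and middle information for both profiles
    have edgeG : min (r - r₁) (r₂ - r) < ε / 2 →
        G r * (1 / (4 * (min (r - r₁) (r₂ - r)) ^ 4) - c2) ≤ cutoffQ r₁ G r := fun h => by
      rw [← hc2]; exact cutoffProfile_edge hε hε2 hr₁ hεc hεr h1r h2r h
    have edgeF : min (z - z₁) (z₂ - z) < ε / 2 →
        F z * (1 / (4 * (min (z - z₁) (z₂ - z)) ^ 4) - c2) ≤ cutoffQ r₁ F z := fun h => by
      rw [← hc2]; exact cutoffProfile_edge hε hε2 hr₁ hεc hεz h1z h2z h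
    have midG : ε / 2 ≤ min (r - r₁) (r₂ - r) → mG ≤ G r ∧ -MG ≤ cutoffQ r₁ G r :=
        fun h => by
      rw [le_min_iff] at h
      exact hGmid r (by linarith [h.1]) (by linarith [h.2])
    have midF : ε / 2 ≤ min (z - z₁) (z₂ - z) → mF ≤ F z ∧ -MF ≤ cutoffQ r₁ F z :=
        fun h => by
      rw [le_min_iff] at h
      exact hFmid z (by linarith [h.1]) (by linarith [h.2])
    rcases hstrip with hsrd | hszd
    · -- the point is within `d` of a vertical edge `r = r₁` or `r = r₂`
      have hKs : K ≤ 1 / (4 * (min (r - r₁) (r₂ - r)) ^ 4) := hdK _ hsr0 hsrd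
      have hQG := edgeG (hsrd.trans_lt hdε)
      have hA1 : G r * L ≤ deriv (deriv G) r + r⁻¹ * deriv G r - G r / r ^ 2 := by
        have : G r * L ≤ G r * (1 / (4 * (min (r - r₁) (r₂ - r)) ^ 4) - c2) :=
          mul_le_mul_of_nonneg_left (by linarith) hGpos.le
        linarith
      have halt : (F z * (1 / (4 * (min (z - z₁) (z₂ - z)) ^ 4) - c2) ≤ cutoffQ r₁ F z ∧
          0 ≤ 1 / (4 * (min (z - z₁) (z₂ - z)) ^ 4)) ∨
          (mF ≤ F z ∧ -MF ≤ cutoffQ r₁ F z) := by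
        rcases lt_or_ge (min (z - z₁) (z₂ - z)) (ε / 2) with hze | hzm
        · exact Or.inl ⟨edgeF hze, by positivity⟩
        · exact Or.inr (midF hzm)
      exact cutoff_strip_core hGpos hFpos hA1 hFQ halt hLc hL0 hLF
    · -- the point is within `d` of a horizontal edge `z = z₁` or `z = z₂`
      have hKs : K ≤ 1 / (4 * (min (z - z₁) (z₂ - z)) ^ 4) := hdK _ hsz0 hszd
      have hQF := edgeF (hszd.trans_lt hdε)
      have hF1 : F z * L ≤ deriv (deriv F) z := by
        have : F z * L ≤ F z * (1 / (4 * (min (z - z₁) (z₂ - z)) ^ 4) - c2) :=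
          mul_le_mul_of_nonneg_left (by linarith) hFpos.le
        linarith
      have halt : (G r * (1 / (4 * (min (r - r₁) (r₂ - r)) ^ 4) - c2) ≤ cutoffQ r₁ G r ∧
          0 ≤ 1 / (4 * (min (r - r₁) (r₂ - r)) ^ 4)) ∨
          (mG ≤ G r ∧ -MG ≤ cutoffQ r₁ G r) := by
        rcases lt_or_ge (min (r - r₁) (r₂ - r)) (ε / 2) with hre | hrm
        · exact Or.inl ⟨edgeG hre, by positivity⟩
        · exact Or.inr (midG hrm)
      have h := cutoff_strip_core hFpos hGpos hF1 hAQ halt hLc hL0 hLG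
      linarith
  · -- symmetry about the axial midline
    intro r z
    change cutoffProfile r₁ r₂ ε r * cutoffProfile z₁ z₂ ε ((z₁ + z₂) / 2 - z) =
      cutoffProfile r₁ r₂ ε r * cutoffProfile z₁ z₂ ε ((z₁ + z₂) / 2 + z)
    rw [← cutoffProfile_symm z₁ z₂ ε ((z₁ + z₂) / 2 + z)]
    congr 2
    ring

end Literature.Barriers.NavierStokesRegularity
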